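import Summits.Langlands.Langlands.Theorems.LevelOneDyadicTensorCore

/-!
# Level-one dyadic companions, part 6b: kernels of the Artin-tensor core (necessity, exactness, closes)

Second half of the lens-4-g10 `ArtinTensorCore` node (decomp-langlands, 2026-08-30; OFFER STATUS L586): the kernels over the
vocabulary and pieces of part 6a `LevelOneDyadicTensorCore` — KERNEL I necessity (T ⟹ TF, D†, TF♭; T′ ⟹ R′, CT′; `Langlands` ⟹ all),
KERNEL II exactness (D′ ⟸ C♯ ∧ TF = k = 4β; D′ ⟸ C ∧ D† = k = 4α; E from either re-split; the closure T′ ⟺ R′ ∧ CT′ by strong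
induction on the dimension inside the potentially-level-one class; TF ⟸ TFℓ ∧ TF♭, TFℓ ⟸ TT), KERNEL III closes (the pieces + the
lineage frame ⟹ `_root_.Langlands` through part 5's `langlands_of_pieces₉` / part 4's `langlands_of_four`).  Split off from the node
file only to respect the 400-line rule for files with proofs; texts unchanged, 0 sorry, axioms standard.
-/

set_option linter.dupNamespace false

namespace Summit.Langlands.Langlands.Theorems.LevelOneDyadic.TensorCore

open scoped NumberField
open Filter IsDedekindDomain
open Literature.NumberTheory.GaloisRepresentations Literature.NumberTheory.Automorphic
open Summit.Langlands.Langlands.Theorems.LevelOneDyadic (IsPinnedGeometric IsCrystallineAbove IsUnramifiedAwayFrom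
  CompanionMatch DyadicContinuousCompanion DyadicCompanionExistence DyadicDeRhamRigidity DyadicIrreducibilityTransfer
  DyadicLevelTransfer dyadicContinuousCompanion_iff dyadicContinuousCompanion_of_langlands dyadicContinuousCompanion_of_E
  dyadicCompanionExistence_of_TG)
open Summit.Langlands.Langlands.Theorems.LevelOneDyadic.Clifford (HasDyadicCompanion DimSlice IsLieIrreducible IsIsotypicPattern
  LieIrreducibleCompanion CliffordCompanionStep IsotypicCompanionDescent CliffordReduction lieIrreducibleCompanion_iff
  cliffordCompanionStep_iff isotypicCompanionDescent_iff cliffordReduction_iff routeT_iff_slices pos_and_lt_of_two_le_mul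
  dyadicContinuousCompanion_of_pieces dyadicCompanionExistence_of_pieces lieIrreducibleCompanion_of_T cliffordCompanionStep_of_T
  langlands_of_pieces₉)

/-! ## KERNEL I — NECESSITY: every new open piece follows from T (hence from E and from `Langlands`); T′ from 18969 and from
`Langlands`; D† from D. -/

section Necessity

/-- **T ⟹ TF** (specialisation: TF's conclusion is T's conclusion for ρ). -/
theorem artinTensorCore_of_T (hT : DyadicContinuousCompanion) : ArtinTensorCore := by
  rw [artinTensorCore_iff]
  intro K _ _ n hn ℓ _ hℓ ι ρ hirr hgeo hcrys hlvl m a _ _ σ τ _ _ _ _ _ _ ι₂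
  exact (dyadicContinuousCompanion_iff.mp hT) K n hn ℓ hℓ ι ρ hirr hgeo hcrys hlvl ι₂

/-- **T ⟹ D†**. -/
theorem isotypicCompanionDescentIH_of_T (hT : DyadicContinuousCompanion) : IsotypicCompanionDescentIH := by
  rw [isotypicCompanionDescentIH_iff]
  intro K _ _ n hn ℓ _ hℓ ι ρ hirr hgeo hcrys hlvl _ L _ _ _ _ m a _ _ σ _ _ _ _ _ ι₂ _
  exact (dyadicContinuousCompanion_iff.mp hT) K n hn ℓ hℓ ι ρ hirr hgeo hcrys hlvl ι₂

/-- **D ⟹ D†** (D† only adds a hypothesis). -/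
theorem isotypicCompanionDescentIH_of_D (hD : IsotypicCompanionDescent) : IsotypicCompanionDescentIH := by
  rw [isotypicCompanionDescentIH_iff]
  rw [isotypicCompanionDescent_iff] at hD
  intro K _ _ n hn ℓ _ hℓ ι ρ hirr hgeo hcrys hlvl _ih L _ _ _ _ m a ha ham σ hσirr hσgeo hσcrys hσlvl hpat ι₂ hσ₂
  exact hD K n hn ℓ hℓ ι ρ hirr hgeo hcrys hlvl L m a ha ham σ hσirr hσgeo hσcrys hσlvl hpat ι₂ hσ₂

/-- **TF ⟹ TFℓ** (a level-one σ is potentially level one). -/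
theorem levelOneTensorStep_of_TF (h : ArtinTensorCore) : LevelOneTensorStep := by
  rw [levelOneTensorStep_iff]; rw [artinTensorCore_iff] at h
  intro K _ _ n hn ℓ _ hℓ ι ρ hirr hgeo hcrys hlvl m a ha ham σ τ hσirr hσgeo hσcrys hσlvl hfin hkron ih ι₂
  exact h K n hn ℓ hℓ ι ρ hirr hgeo hcrys hlvl m a ha ham σ τ hσirr hσgeo (isPotentiallyLevelOne_of_levelOne hσcrys hσlvl)
    hfin hkron ih ι₂

/-- **TF ⟹ TF♭** (drop the non-liftability hypothesis). -/
theorem nonLiftableTensorCore_of_TF (h : ArtinTensorCore) : NonLiftableTensorCore := by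
  rw [nonLiftableTensorCore_iff]; rw [artinTensorCore_iff] at h
  intro K _ _ n hn ℓ _ hℓ ι ρ hirr hgeo hcrys hlvl m a ha ham σ τ hσirr hσgeo hσpot hfin hkron _ ih ι₂
  exact h K n hn ℓ hℓ ι ρ hirr hgeo hcrys hlvl m a ha ham σ τ hσirr hσgeo hσpot hfin hkron ih ι₂

/-- Necessity: T ⟹ TF♭ (through TF). -/
theorem nonLiftableTensorCore_of_T (hT : DyadicContinuousCompanion) : NonLiftableTensorCore :=
  nonLiftableTensorCore_of_TF (artinTensorCore_of_T hT)

/-- Necessity: `Langlands` ⟹ TF♭ (through T). -/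
theorem nonLiftableTensorCore_of_langlands (hLg : _root_.Langlands) : NonLiftableTensorCore :=
  nonLiftableTensorCore_of_T (dyadicContinuousCompanion_of_langlands hLg)

/-- Necessity: E ⟹ TF (through T). -/
theorem artinTensorCore_of_E (hE : DyadicCompanionExistence) : ArtinTensorCore :=
  artinTensorCore_of_T (dyadicContinuousCompanion_of_E hE)

/-- Necessity: E ⟹ D† (through T). -/
theorem isotypicCompanionDescentIH_of_E (hE : DyadicCompanionExistence) : IsotypicCompanionDescentIH :=
  isotypicCompanionDescentIH_of_T (dyadicContinuousCompanion_of_E hE)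

/-- **NECESSITY CERTIFICATE: `Langlands ⟹ TF`.** -/
theorem artinTensorCore_of_langlands (hLg : _root_.Langlands) : ArtinTensorCore :=
  artinTensorCore_of_T (dyadicContinuousCompanion_of_langlands hLg)

/-- **NECESSITY CERTIFICATE: `Langlands ⟹ D†`.** -/
theorem isotypicCompanionDescentIH_of_langlands (hLg : _root_.Langlands) : IsotypicCompanionDescentIH :=
  isotypicCompanionDescentIH_of_T (dyadicContinuousCompanion_of_langlands hLg)

/-- **T′ ⟹ T** (level one is potentially level one). -/
theorem routeT_of_potCompanion (h : PotentiallyLevelOneCompanion) : DyadicContinuousCompanion := by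
  rw [dyadicContinuousCompanion_iff]
  rw [potCompanion_iff] at h
  intro K _ _ n hn ℓ _ hℓ ι ρ hirr hgeo hcrys hlvl ι₂
  exact h K n hn ℓ hℓ ι ρ hirr hgeo (isPotentiallyLevelOne_of_levelOne hcrys hlvl) ι₂

/-- **T′ ⟹ R′** and **T′ ⟹ CT′** (drop hypotheses). -/
theorem potLieCompanion_of_potCompanion (h : PotentiallyLevelOneCompanion) : PotentiallyLevelOneLieIrreducibleCompanion := by
  rw [potLieCompanion_iff]; rw [potCompanion_iff] at h
  intro K _ _ n hn ℓ _ hℓ ι ρ hirr _ hgeo hpot ι₂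
  exact h K n hn ℓ hℓ ι ρ hirr hgeo hpot ι₂

/-- Necessity: T′ ⟹ CT′ (drop the induction hypothesis). -/
theorem potCliffordTateStep_of_potCompanion (h : PotentiallyLevelOneCompanion) : PotentialCliffordTateStep := by
  rw [potCliffordTateStep_iff]; rw [potCompanion_iff] at h
  intro K _ _ n hn ℓ _ hℓ ι ρ hirr hgeo hpot _ _ ι₂
  exact h K n hn ℓ hℓ ι ρ hirr hgeo hpot ι₂

/-- **R′ ⟹ R** (the saturated residual dominates the g9 residual). -/
theorem lieIrreducibleCompanion_of_potLie (h : PotentiallyLevelOneLieIrreducibleCompanion) : LieIrreducibleCompanion := by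
  rw [lieIrreducibleCompanion_iff]; rw [potLieCompanion_iff] at h
  intro K _ _ n hn ℓ _ hℓ ι ρ hirr hLie hgeo hcrys hlvl ι₂
  exact h K n hn ℓ hℓ ι ρ hirr hLie hgeo (isPotentiallyLevelOne_of_levelOne hcrys hlvl) ι₂

/-- **T′ ⟸ the OPEN ITEM stmt-Langlands-18969** (`CompatibleFamilySplit.GeometricCompanions`: companions of every irreducible
pinned-geometric ρ at every ℓ′ — no level hypothesis), by name. -/
theorem potCompanion_of_geometricCompanions (h : Summit.Langlands.Langlands.Theses.CompatibleFamilySplit.GeometricCompanions) :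
    PotentiallyLevelOneCompanion := by
  rw [potCompanion_iff]
  intro K _ _ n hn ℓ _ _hℓ ι ρ hirr hgeo _hpot ι₂
  obtain ⟨a, hρa, hall⟩ := h K n hn ℓ ι ρ hirr ⟨hgeo.1, fun v hv => hgeo.2 v hv⟩
  obtain ⟨ρ₂, -, hgeo₂, hρ₂a⟩ := hall 2 ι₂
  refine ⟨ρ₂, hgeo₂.1, ?_⟩
  filter_upwards [hρa, hρ₂a] with v ⟨_, hv⟩ ⟨_, hv₂⟩
  exact ⟨a v, hv, hv₂⟩

/-- **NECESSITY CERTIFICATE: `Langlands ⟹ T′`** ((B) at ℓ gives π for the irreducible pinned-geometric ρ — no level hypothesis —,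
(A) at 2 gives ρ₂, the two Satake clauses give the matching). -/
theorem potCompanion_of_langlands (hLg : _root_.Langlands) : PotentiallyLevelOneCompanion := by
  rw [potCompanion_iff]
  intro K _ _ n hn ℓ _ _hℓ ι ρ hirr hgeo _hpot ι₂
  obtain ⟨⟨Rec⟩, h⟩ := hLg K
  have hcpt : isCompact_glFiniteIntegralLevel n K := isCompact_glFiniteIntegralLevel_holds n K
  obtain ⟨hA, hB⟩ := h Rec n hn hcpt
  obtain ⟨π, hLπ, hcorr⟩ := hB ℓ ι ρ hirr ⟨hgeo.1, fun v hv => hgeo.2 v hv⟩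
  obtain ⟨ρ₂, -, hgeo₂, hcorr₂, -⟩ := hA π hLπ 2 ι₂
  exact ⟨ρ₂, hgeo₂.1, companionMatch_of_satake π hcorr.1 hcorr₂.1⟩

/-- Necessity: `Langlands` ⟹ R′ (through T′). -/
theorem potLieCompanion_of_langlands (hLg : _root_.Langlands) : PotentiallyLevelOneLieIrreducibleCompanion :=
  potLieCompanion_of_potCompanion (potCompanion_of_langlands hLg)

/-- Necessity: `Langlands` ⟹ CT′ (through T′). -/
theorem potCliffordTateStep_of_langlands (hLg : _root_.Langlands) : PotentialCliffordTateStep :=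
  potCliffordTateStep_of_potCompanion (potCompanion_of_langlands hLg)

/-- TT ⟸ T is NOT claimed (TT quantifies over ρ of any level); TT is print.  `Langlands ⟹ TT` is not needed by any glue. -/
example : True := trivial

end Necessity

/-! ## KERNEL II — EXACTNESS.  D′ ⟸ C♯ ∧ TF (k = 4β), D′ ⟸ C ∧ D† (k = 4α), E from either; the closure T′ ⟺ R′ ∧ CT′ and
TF ⟸ T′-slices ∧ TT. -/

section Exactness

/-- **D′ ⟸ C♯ ∧ TF** — the g10 layer-2 glue: a non-Lie-irreducible level-one irreducible ρ is induced from a smaller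
level-one V₁ (IH + C♯'s transport) or has an Artin-tensor shape (TF with the same IH). -/
theorem cliffordCompanionStep_of_shapes (hC : CliffordTateShapes) (hT : ArtinTensorCore) : CliffordCompanionStep := by
  rw [cliffordTateShapes_iff] at hC
  rw [artinTensorCore_iff] at hT
  rw [cliffordCompanionStep_iff]
  intro K _ _ n hn ℓ _ hℓ ι ρ hirr hgeo hcrys hlvl hLie ih ι₂
  rcases hC K n hn ℓ hℓ ρ hirr hgeo hcrys hlvl hLie with
    ⟨L₁, _, _, _, d, m, hd, hdm, _, V₁, hV₁irr, hV₁geo, hV₁crys, hV₁lvl, htransport⟩ |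
    ⟨m, a, ha, ham, σ, τ, hσirr, hσgeo, hσpot, hfin, hkron⟩
  · obtain ⟨hm0, hmn⟩ := pos_and_lt_of_two_le_mul hd hdm hn
    exact htransport ι ι₂ (ih m hmn L₁ hm0 ℓ hℓ ι V₁ hV₁irr hV₁geo hV₁crys hV₁lvl ι₂)
  · exact hT K n hn ℓ hℓ ι ρ hirr hgeo hcrys hlvl m a ha ham σ τ hσirr hσgeo hσpot hfin hkron ih ι₂

/-- **D′ ⟸ C ∧ D†** — the k = 4α layer-2 glue (critic F1): as part 5's `cliffordCompanionStep_of_split`, passing the induction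
hypothesis on to D†. -/
theorem cliffordCompanionStep_of_splitIH (hC : CliffordReduction) (hD : IsotypicCompanionDescentIH) : CliffordCompanionStep := by
  rw [cliffordReduction_iff] at hC
  rw [isotypicCompanionDescentIH_iff] at hD
  rw [cliffordCompanionStep_iff]
  intro K _ _ n hn ℓ _ hℓ ι ρ hirr hgeo hcrys hlvl hLie ih ι₂
  rcases hC K n hn ℓ hℓ ρ hirr hgeo hcrys hlvl hLie with
    ⟨L₁, _, _, _, d, m, hd, hdm, _, V₁, hV₁irr, hV₁geo, hV₁crys, hV₁lvl, htransport⟩ |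
    ⟨L, _, _, _, _, m, a, ha, ham, σ, hσirr, hσgeo, hσcrys, hσlvl, hpat⟩
  · obtain ⟨hm0, hmn⟩ := pos_and_lt_of_two_le_mul hd hdm hn
    exact htransport ι ι₂ (ih m hmn L₁ hm0 ℓ hℓ ι V₁ hV₁irr hV₁geo hV₁crys hV₁lvl ι₂)
  · obtain ⟨hm0, hmn⟩ := pos_and_lt_of_two_le_mul ha ham hn
    exact hD K n hn ℓ hℓ ι ρ hirr hgeo hcrys hlvl ih L m a ha ham σ hσirr hσgeo hσcrys hσlvl hpat ι₂
      (ih m hmn L hm0 ℓ hℓ ι σ hσirr hσgeo hσcrys hσlvl ι₂)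

/-- **T ⟸ R ∧ C♯ ∧ TF** (both layers, k = 4β). -/
theorem dyadicContinuousCompanion_of_threeβ (hR : LieIrreducibleCompanion) (hC : CliffordTateShapes) (hT : ArtinTensorCore) :
    DyadicContinuousCompanion :=
  dyadicContinuousCompanion_of_pieces hR (cliffordCompanionStep_of_shapes hC hT)

/-- **T ⟸ R ∧ C ∧ D†** (both layers, k = 4α). -/
theorem dyadicContinuousCompanion_of_threeα (hR : LieIrreducibleCompanion) (hC : CliffordReduction)
    (hD : IsotypicCompanionDescentIH) : DyadicContinuousCompanion :=
  dyadicContinuousCompanion_of_pieces hR (cliffordCompanionStep_of_splitIH hC hD)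

/-- **E ⟸ R ∧ G ∧ TF ∧ C♯** — glue of the k = 4β resplit of `DyadicCompanionExistence` (tree twins; the kit's
`resplit4b_glue.lean` proves the same over the gate render). -/
theorem dyadicCompanionExistence_of_resplit4β (hR : LieIrreducibleCompanion) (hG : DyadicDeRhamRigidity) (hT : ArtinTensorCore)
    (hC : CliffordTateShapes) : DyadicCompanionExistence :=
  dyadicCompanionExistence_of_TG (dyadicContinuousCompanion_of_threeβ hR hC hT) hG

/-- **E ⟸ R ∧ G ∧ D† ∧ C** — glue of the k = 4α resplit (critic F1 shape). -/
theorem dyadicCompanionExistence_of_resplit4α (hR : LieIrreducibleCompanion) (hG : DyadicDeRhamRigidity)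
    (hD : IsotypicCompanionDescentIH) (hC : CliffordReduction) : DyadicCompanionExistence :=
  dyadicCompanionExistence_of_TG (dyadicContinuousCompanion_of_threeα hR hC hD) hG

/-- **CLOSURE, layer 1: T′ ⟸ R′ ∧ CT′** by strong induction on the dimension over the potentially-level-one slices — the
minimal counterexample in the CLOSED class is Lie-irreducible. -/
theorem potCompanion_of_pieces (hR : PotentiallyLevelOneLieIrreducibleCompanion) (hS : PotentialCliffordTateStep) :
    PotentiallyLevelOneCompanion := by
  rw [potLieCompanion_iff] at hR
  rw [potCliffordTateStep_iff] at hS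
  rw [potCompanion_iff_slices]
  intro n
  induction n using Nat.strong_induction_on with
  | _ n ih =>
    intro K _ _ hn ℓ _ hℓ ι ρ hirr hgeo hpot ι₂
    by_cases hLie : IsLieIrreducible ρ
    · exact hR K n hn ℓ hℓ ι ρ hirr hLie hgeo hpot ι₂
    · exact hS K n hn ℓ hℓ ι ρ hirr hgeo hpot hLie ih ι₂

/-- **CLOSURE IS EXACT: T′ ⟺ R′ ∧ CT′** — and CT′ is print, so modulo print T′ ≡ R′. -/
theorem potCompanion_iff_pieces :
    PotentiallyLevelOneCompanion ↔ (PotentiallyLevelOneLieIrreducibleCompanion ∧ PotentialCliffordTateStep) :=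
  ⟨fun h => ⟨potLieCompanion_of_potCompanion h, potCliffordTateStep_of_potCompanion h⟩, fun h => potCompanion_of_pieces h.1 h.2⟩

/-- **TF ⟸ (T′ below n) ∧ TT**: the Artin-tensor core at dimension n is discharged by potentially-level-one companions in the
dimensions m < n dividing n (the tensor factor σ) and the print transport TT — the level-one induction hypothesis is not used.
This is the typed form of «D′'s dark core is R′ in lower dimensions, not a descent problem». -/
theorem artinTensorCore_of_potSlices (hP : ∀ m : ℕ, DimSlicePot m) (hTT : TensorCompanionTransport) : ArtinTensorCore := by
  rw [artinTensorCore_iff]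
  rw [tensorCompanionTransport_iff] at hTT
  intro K _ _ n hn ℓ _ hℓ ι ρ _hirr _hgeo _hcrys _hlvl m a ha ham σ τ hσirr hσgeo hσpot hfin hkron _ih ι₂
  obtain ⟨hm0, _⟩ := pos_and_lt_of_two_le_mul ha ham hn
  exact hTT K n hn ℓ hℓ ι ρ m a ham σ τ hfin hkron ι₂ (hP m K hm0 ℓ hℓ ι σ hσirr hσgeo hσpot ι₂)

/-- **TF ⟸ TFℓ ∧ TF♭** — excluded middle on liftability: the Artin-tensor core is its print liftable half plus the typed
non-liftable core. -/
theorem artinTensorCore_of_lift_core (hL : LevelOneTensorStep) (hN : NonLiftableTensorCore) : ArtinTensorCore := by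
  rw [artinTensorCore_iff]
  rw [levelOneTensorStep_iff] at hL
  rw [nonLiftableTensorCore_iff] at hN
  intro K _ _ n hn ℓ _ hℓ ι ρ hirr hgeo hcrys hlvl m a ha ham σ τ hσirr hσgeo hσpot hfin hkron ih ι₂
  by_cases hlift : HasLevelOneTensorShape ρ m a
  · obtain ⟨σ', τ', hσ'irr, hσ'geo, hσ'crys, hσ'lvl, hfin', hkron'⟩ := hlift
    exact hL K n hn ℓ hℓ ι ρ hirr hgeo hcrys hlvl m a ha ham σ' τ' hσ'irr hσ'geo hσ'crys hσ'lvl hfin' hkron' ih ι₂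
  · exact hN K n hn ℓ hℓ ι ρ hirr hgeo hcrys hlvl m a ha ham σ τ hσirr hσgeo hσpot hfin hkron hlift ih ι₂

/-- **TFℓ ⟸ TT** — the liftable half is print modulo the print transport: the level-one induction hypothesis at dimension
m < n over K itself gives σ₂. -/
theorem levelOneTensorStep_of_TT (hTT : TensorCompanionTransport) : LevelOneTensorStep := by
  rw [levelOneTensorStep_iff]
  rw [tensorCompanionTransport_iff] at hTT
  intro K _ _ n hn ℓ _ hℓ ι ρ _ _ _ _ m a ha ham σ τ hσirr hσgeo hσcrys hσlvl hfin hkron ih ι₂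
  obtain ⟨hm0, hmn⟩ := pos_and_lt_of_two_le_mul ha ham hn
  exact hTT K n hn ℓ hℓ ι ρ m a ham σ τ hfin hkron ι₂ (ih m hmn K hm0 ℓ hℓ ι σ hσirr hσgeo hσcrys hσlvl ι₂)

/-- **TF♭ ⟸ (T′ below n) ∧ TT** — the non-liftable core is discharged by potentially-level-one companions in dimension m. -/
theorem nonLiftableTensorCore_of_potSlices (hP : ∀ m : ℕ, DimSlicePot m) (hTT : TensorCompanionTransport) :
    NonLiftableTensorCore :=
  nonLiftableTensorCore_of_TF (artinTensorCore_of_potSlices hP hTT)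

/-- Hence **D′ ⟸ C♯ ∧ TT ∧ TF♭**: modulo the two print supports, the Clifford step IS the non-liftable tensor core. -/
theorem cliffordCompanionStep_of_core (hC : CliffordTateShapes) (hTT : TensorCompanionTransport) (hN : NonLiftableTensorCore) :
    CliffordCompanionStep :=
  cliffordCompanionStep_of_shapes hC (artinTensorCore_of_lift_core (levelOneTensorStep_of_TT hTT) hN)

/-- Hence **TF ⟸ T′ ∧ TT**. -/
theorem artinTensorCore_of_potCompanion (hP : PotentiallyLevelOneCompanion) (hTT : TensorCompanionTransport) : ArtinTensorCore :=
  artinTensorCore_of_potSlices (potCompanion_iff_slices.mp hP) hTT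

/-- **The closure pieces dominate the whole level-one tower: T ⟸ R′ ∧ CT′.** -/
theorem routeT_of_closure (hR : PotentiallyLevelOneLieIrreducibleCompanion) (hS : PotentialCliffordTateStep) :
    DyadicContinuousCompanion :=
  routeT_of_potCompanion (potCompanion_of_pieces hR hS)

/-- **E ⟸ R′ ∧ CT′ ∧ G.** -/
theorem dyadicCompanionExistence_of_closure (hR : PotentiallyLevelOneLieIrreducibleCompanion) (hS : PotentialCliffordTateStep)
    (hG : DyadicDeRhamRigidity) : DyadicCompanionExistence :=
  dyadicCompanionExistence_of_TG (routeT_of_closure hR hS) hG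

end Exactness

/-! ## KERNEL III — the pieces + the lineage frame ⟹ `_root_.Langlands` (through part 5's `langlands_of_pieces₉`) -/

section Closes

open Summit.Langlands.Langlands.Theses

/-- k = 4β: **R C♯ TF + G I U + the MinimalLevelDescent frame ⟹ Langlands** (fifteen binders). -/
theorem langlands_of_pieces₁₀β (hR : LieIrreducibleCompanion) (hC : CliffordTateShapes) (hT : ArtinTensorCore)
    (hG : DyadicDeRhamRigidity) (hI : DyadicIrreducibilityTransfer) (hU : DyadicLevelTransfer) (hK : ResidualInertiaDescent)
    (hWM : MinimalLevelDescent.WeightMove) (hLM : MinimalLevelDescent.LevelMove)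
    (hB : MinimalLevelDescent.DyadicLevelOneAutomorphy) (hL : MinimalLevelDescent.AutomorphyLifting)
    (hW : MinimalLevelDescent.SatakeAvatarExistence) (hP : MinimalLevelDescent.PadicMemberCompatibility)
    (hA : MinimalLevelDescent.CompatibilityAwayFromLR) (hCRD : MinimalLevelDescent.CanonicalReciprocityData) :
    _root_.Langlands :=
  langlands_of_pieces₉ hR (cliffordCompanionStep_of_shapes hC hT) hG hI hU hK hWM hLM hB hL hW hP hA hCRD

/-- k = 4α: **R C D† + G I U + frame ⟹ Langlands** (fifteen binders). -/
theorem langlands_of_pieces₁₀α (hR : LieIrreducibleCompanion) (hC : CliffordReduction) (hD : IsotypicCompanionDescentIH)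
    (hG : DyadicDeRhamRigidity) (hI : DyadicIrreducibilityTransfer) (hU : DyadicLevelTransfer) (hK : ResidualInertiaDescent)
    (hWM : MinimalLevelDescent.WeightMove) (hLM : MinimalLevelDescent.LevelMove)
    (hB : MinimalLevelDescent.DyadicLevelOneAutomorphy) (hL : MinimalLevelDescent.AutomorphyLifting)
    (hW : MinimalLevelDescent.SatakeAvatarExistence) (hP : MinimalLevelDescent.PadicMemberCompatibility)
    (hA : MinimalLevelDescent.CompatibilityAwayFromLR) (hCRD : MinimalLevelDescent.CanonicalReciprocityData) :
    _root_.Langlands :=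
  langlands_of_pieces₉ hR (cliffordCompanionStep_of_splitIH hC hD) hG hI hU hK hWM hLM hB hL hW hP hA hCRD

/-- closure: **R′ CT′ + G I U + frame ⟹ Langlands** (fourteen binders; R′ CT′ replace R D′). -/
theorem langlands_of_closure (hR : PotentiallyLevelOneLieIrreducibleCompanion) (hS : PotentialCliffordTateStep)
    (hG : DyadicDeRhamRigidity) (hI : DyadicIrreducibilityTransfer) (hU : DyadicLevelTransfer) (hK : ResidualInertiaDescent)
    (hWM : MinimalLevelDescent.WeightMove) (hLM : MinimalLevelDescent.LevelMove)
    (hB : MinimalLevelDescent.DyadicLevelOneAutomorphy) (hL : MinimalLevelDescent.AutomorphyLifting)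
    (hW : MinimalLevelDescent.SatakeAvatarExistence) (hP : MinimalLevelDescent.PadicMemberCompatibility)
    (hA : MinimalLevelDescent.CompatibilityAwayFromLR) (hCRD : MinimalLevelDescent.CanonicalReciprocityData) :
    _root_.Langlands :=
  langlands_of_four (routeT_of_closure hR hS) hG hI hU hK hWM hLM hB hL hW hP hA hCRD

end Closes

end Summit.Langlands.Langlands.Theorems.LevelOneDyadic.TensorCore
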